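import Literature.NumberTheory.GelbartRogawski1991.LocalUnitaryBlockRestriction
import Literature.NumberTheory.GelbartRogawski1991.LocalDoubledUnitarySiegel
import Literature.RepresentationTheory.HeisenbergGroup.MetaplecticBoxHom
import HarnessLib

-- buildfix G11b-3 recipe (LEDGER B13-1/B13-3), as in the GelbartRogawski1991 siblings: elaborate sequentially so the
-- trailing `attribute [implicit_reducible]` block is in force at `.olean` export (inert for the kernel).
set_option Elab.async false

/-!
# The doubled block embedding `U(𝔻_{V₁})(F_v) ↪ U(𝔻_{V₁ ⊥ V₂})(F_v)` at a finite place: `𝔻_{V₁ ⊥ V₂} = 𝔻_{V₁} ⊥ 𝔻_{V₂}`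

Topic `NumberTheory/GelbartRogawski1991`; namespace `Literature.NumberTheory.GelbartRogawski1991.UnitaryDualPair.LocalSplitting.DoubledBlock`.
KERNEL MATHEMATICS ONLY: plumbing definitions with bodies (an index shuffle, three homomorphisms) + theorems; no named fact, no
instance, no `sorry`.  The LOCAL, one-place twin of the tree's adelic `DoubledBlockDiagEmbedding` (`idxSplitD`, `blkD`, `toSpD_blkD`),
written for the local see-saw of Kudla's splitting ([Kudla1994, Thm. 3.1]: the `χ`-splitting of `U(V₁ ⊥ V₂)` restricts to the
`χ`-splitting of `U(V₁)`; [Kudla1984, §1]; [MoeglinVignerasWaldspurger1987, Chap. 2 II.1 Rem. (6)]).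

Setting: `E/F` quadratic with `c`, a finite place `v`, symmetric Gram matrices `T₁ ∈ M_{n₁}(F)`, `T₂ ∈ M_{n₂}(F)`, their orthogonal
sum `T = T₁ ⊕ᶠ T₂ = UnitaryGroup.finSum n₁ n₂ T₁ T₂`, and the DOUBLED Gram matrices `gramD F (n₁ + n₂) T`, `gramD F n₁ T₁`,
`gramD F n₂ T₂` of `LocalDoubledUnitaryDatum`.

* §1 the index shuffle **`blkIdx : Fin (n₁+n₁) ⊕ Fin (n₂+n₂) ≃ Fin ((n₁+n₂)+(n₁+n₂))`** (`(V₁ ⊕ V₁⁻) ⊕ (V₂ ⊕ V₂⁻) = (V₁ ⊕ V₂) ⊕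
  (V₁⁻ ⊕ V₂⁻)`, `Equiv.sumSumSumComm`) and **`gramD (T₁ ⊕ᶠ T₂) = reindex blkIdx blkIdx (gramD T₁ ⊕ gramD T₂)`** (`gramD_finSum`,
  `localGram_gramD_finSum`);
* §2 the block embedding **`blkLoc : U(J₁^𝔻)(F_v) →* U(J^𝔻)(F_v)`**, `h ↦ blkIdx-reindex of diag(h, 1)` (matrix form `blkLocal`),
  continuous, with components (`blkLoc_apply`), and **`ι^𝔻(blkLoc h) = spInl blkIdx (ι₁^𝔻 h)`** (`iota_blkLoc`);
* §3 the block section of a doubled section `s : U(J^𝔻)(F_v) →* S̃p(𝕎^𝔻_T)` over `ι^𝔻_T`: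
  **`restrictBlk s : U(J₁^𝔻)(F_v) →* S̃p(𝕎^𝔻_{T₁})`** (sum-stripping of `s ∘ blkLoc` along `blkIdx`, `MetaplecticSumStripping.undouble`),
  over `ι^𝔻_{T₁}` (`proj_restrictBlk`), `ω(s (blkLoc h))(Φ₁ ⊠_{blkIdx} Φ₂) = ω(restrictBlk s h) Φ₁ ⊠ Φ₂` (`toRep_blkLoc_boxSB`); and
  Kudla's `j̃` at the local doubled models **`boxLoc`** (`MpPsi.boxHom` along `blkIdx`, typed at `LocalMp`), `proj_boxLoc`,
  `toRep_boxLoc_boxSB`, `toOp_boxLoc`.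

Sequels: `LocalDoubledBlockSiegel`, `LocalSplittingCMBlockRestriction` (the local see-saw `restrictLeft (s_χ^{V₁ ⊥ V₂}) = s_χ^{V₁}`
for the CM packages).  Cell `hodgecm-mathlib`, crux H413 programme P2, N3 road (a), brick (LS).  HC_CM is NOT proved here and is
proved only modulo the printed citations until rung 0 closes.

## References
* [Kudla1984] S. Kudla, *Seesaw dual reductive pairs*, Progr. Math. 46 (1984), §1.
* [Kudla1994] S. Kudla, *Splitting metaplectic covers of dual reductive pairs*, Israel J. Math. 87 (1994), §2–§3, Thm. 3.1.
* [HarrisKudlaSweet1996] M. Harris, S. Kudla, W. Sweet, J. AMS 9 (1996), §1 (1.9)–(1.11).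
* [MoeglinVignerasWaldspurger1987] LNM 1291 (1987), Chap. 2 II.1 Rem. (6).
-/

set_option autoImplicit false

noncomputable section

open NumberField IsDedekindDomain Matrix
open Literature.RepresentationTheory.HeisenbergGroup
open Literature.NumberTheory.Automorphic Literature.NumberTheory.Weil1964

namespace Literature.NumberTheory.GelbartRogawski1991.UnitaryDualPair.LocalSplitting

namespace DoubledBlock

variable (F : Type) [Field F] [NumberField F] (E : Type) [Field E] [NumberField E] [Algebra F E] (c : E ≃ₐ[F] E)
  (v : HeightOneSpectrum (𝓞 F)) (n₁ n₂ : ℕ) {T₁ : Matrix (Fin n₁) (Fin n₁) F} {T₂ : Matrix (Fin n₂) (Fin n₂) F}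
  {JD₁ : Matrix (Fin (n₁ + n₁)) (Fin (n₁ + n₁)) E} (hJD₁ : JD₁ = (gramD F n₁ T₁).map (algebraMap F E))
  {JD₂ : Matrix (Fin (n₂ + n₂)) (Fin (n₂ + n₂)) E} (hJD₂ : JD₂ = (gramD F n₂ T₂).map (algebraMap F E))
  {JD : Matrix (Fin ((n₁ + n₂) + (n₁ + n₂))) (Fin ((n₁ + n₂) + (n₁ + n₂))) E}
  (hJD : JD = (gramD F (n₁ + n₂) (UnitaryGroup.finSum n₁ n₂ T₁ T₂)).map (algebraMap F E))

local notation "Fv" => v.adicCompletion F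
/-- the concatenation `Fin n₁ ⊕ Fin n₂ ≃ Fin (n₁ + n₂)`. -/
local notation "eS" => (finSumFinEquiv : Fin n₁ ⊕ Fin n₂ ≃ Fin (n₁ + n₂))
set_option quotPrecheck false in
/-- the local form matrix of `J₁^𝔻`. -/
local notation "HD₁" => Matrix.map (localGram F (n₁ + n₁) (gramD F n₁ T₁) v) (UnitaryGroup.toLocalRing E v)
set_option quotPrecheck false in
/-- the local form matrix of `J₂^𝔻`. -/
local notation "HD₂" => Matrix.map (localGram F (n₂ + n₂) (gramD F n₂ T₂) v) (UnitaryGroup.toLocalRing E v)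
set_option quotPrecheck false in
/-- `ψ_v` is locally constant. -/
local notation "hlv" => isLocallyConstant_of_isContinuousNontrivial (isContinuousNontrivial_adeleAddCharAt F v)
set_option quotPrecheck false in
/-- `ψ_v` is continuous and non-trivial. -/
local notation "hψv" => isContinuousNontrivial_adeleAddCharAt F v

/-! ## §1 The index shuffle and `gramD (T₁ ⊕ᶠ T₂) = reindex (gramD T₁ ⊕ gramD T₂)` -/

/-- **`(V₁ ⊕ V₁⁻) ⊕ (V₂ ⊕ V₂⁻) ≃ (V₁ ⊕ V₂) ⊕ (V₁⁻ ⊕ V₂⁻)`** on the `Fin` enumerations: the index shuffle between the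
doubled space of the sum and the sum of the doubled spaces. [cite: Kudla1994, §2] -/
def blkIdx : Fin (n₁ + n₁) ⊕ Fin (n₂ + n₂) ≃ Fin ((n₁ + n₂) + (n₁ + n₂)) :=
  ((e₂ n₁).symm.sumCongr (e₂ n₂).symm).trans
    ((Equiv.sumSumSumComm (Fin n₁) (Fin n₁) (Fin n₂) (Fin n₂)).trans
      ((finSumFinEquiv.sumCongr finSumFinEquiv).trans (e₂ (n₁ + n₂))))

/-- `V₁ ⊂ V₁ ⊕ V₁⁻` goes to `V₁ ⊂ V ⊂ V ⊕ V⁻`. [cite: Kudla1994, §2] -/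
@[simp] theorem blkIdx_inl_inl (i : Fin n₁) :
    blkIdx n₁ n₂ (Sum.inl (e₂ n₁ (Sum.inl i))) = e₂ (n₁ + n₂) (Sum.inl (eS (Sum.inl i))) := by
  simp only [blkIdx, Equiv.trans_apply, Equiv.sumCongr_apply, Sum.map_inl, Equiv.symm_apply_apply]
  rfl

/-- `V₁⁻ ⊂ V₁ ⊕ V₁⁻` goes to `V₁⁻ ⊂ V⁻ ⊂ V ⊕ V⁻`. [cite: Kudla1994, §2] -/
@[simp] theorem blkIdx_inl_inr (i : Fin n₁) :
    blkIdx n₁ n₂ (Sum.inl (e₂ n₁ (Sum.inr i))) = e₂ (n₁ + n₂) (Sum.inr (eS (Sum.inl i))) := by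
  simp only [blkIdx, Equiv.trans_apply, Equiv.sumCongr_apply, Sum.map_inl, Equiv.symm_apply_apply]
  rfl

/-- `V₂ ⊂ V₂ ⊕ V₂⁻` goes to `V₂ ⊂ V ⊂ V ⊕ V⁻`. [cite: Kudla1994, §2] -/
@[simp] theorem blkIdx_inr_inl (j : Fin n₂) :
    blkIdx n₁ n₂ (Sum.inr (e₂ n₂ (Sum.inl j))) = e₂ (n₁ + n₂) (Sum.inl (eS (Sum.inr j))) := by
  simp only [blkIdx, Equiv.trans_apply, Equiv.sumCongr_apply, Sum.map_inr, Equiv.symm_apply_apply]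
  rfl

/-- `V₂⁻ ⊂ V₂ ⊕ V₂⁻` goes to `V₂⁻ ⊂ V⁻ ⊂ V ⊕ V⁻`. [cite: Kudla1994, §2] -/
@[simp] theorem blkIdx_inr_inr (j : Fin n₂) :
    blkIdx n₁ n₂ (Sum.inr (e₂ n₂ (Sum.inr j))) = e₂ (n₁ + n₂) (Sum.inr (eS (Sum.inr j))) := by
  simp only [blkIdx, Equiv.trans_apply, Equiv.sumCongr_apply, Sum.map_inr, Equiv.symm_apply_apply]
  rfl

/-- inverse shuffle on `V₁ ⊂ V`. [cite: Kudla1994, §2] -/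
@[simp] theorem blkIdx_symm_inl_inl (i : Fin n₁) :
    (blkIdx n₁ n₂).symm (e₂ (n₁ + n₂) (Sum.inl (eS (Sum.inl i)))) = Sum.inl (e₂ n₁ (Sum.inl i)) := by
  rw [Equiv.symm_apply_eq, blkIdx_inl_inl]

/-- inverse shuffle on `V₁⁻ ⊂ V⁻`. [cite: Kudla1994, §2] -/
@[simp] theorem blkIdx_symm_inr_inl (i : Fin n₁) :
    (blkIdx n₁ n₂).symm (e₂ (n₁ + n₂) (Sum.inr (eS (Sum.inl i)))) = Sum.inl (e₂ n₁ (Sum.inr i)) := by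
  rw [Equiv.symm_apply_eq, blkIdx_inl_inr]

/-- inverse shuffle on `V₂ ⊂ V`. [cite: Kudla1994, §2] -/
@[simp] theorem blkIdx_symm_inl_inr (j : Fin n₂) :
    (blkIdx n₁ n₂).symm (e₂ (n₁ + n₂) (Sum.inl (eS (Sum.inr j)))) = Sum.inr (e₂ n₂ (Sum.inl j)) := by
  rw [Equiv.symm_apply_eq, blkIdx_inr_inl]

/-- inverse shuffle on `V₂⁻ ⊂ V⁻`. [cite: Kudla1994, §2] -/
@[simp] theorem blkIdx_symm_inr_inr (j : Fin n₂) :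
    (blkIdx n₁ n₂).symm (e₂ (n₁ + n₂) (Sum.inr (eS (Sum.inr j)))) = Sum.inr (e₂ n₂ (Sum.inr j)) := by
  rw [Equiv.symm_apply_eq, blkIdx_inr_inr]

omit [NumberField F] in
/-- entries of a doubled Gram matrix in the `e₂` enumeration. [cite: HarrisKudlaSweet1996, §1 (1.9)] -/
theorem gramD_apply {n : ℕ} (T₀ : Matrix (Fin n) (Fin n) F) (a b : Fin n ⊕ Fin n) :
    gramD F n T₀ (e₂ n a) (e₂ n b) = Matrix.fromBlocks T₀ 0 0 (-T₀) a b := by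
  simp only [gramD, Matrix.reindex_apply, Matrix.submatrix_apply, Equiv.symm_apply_apply]

omit [NumberField F] in
/-- entries of `T₁ ⊕ᶠ T₂` in the `finSumFinEquiv` enumeration. [cite: Kudla1984, §1] -/
theorem finSum_apply (a b : Fin n₁ ⊕ Fin n₂) :
    UnitaryGroup.finSum n₁ n₂ T₁ T₂ (eS a) (eS b) = Matrix.fromBlocks T₁ 0 0 T₂ a b := by
  simp only [UnitaryGroup.finSum, Matrix.reindex_apply, Matrix.submatrix_apply, Equiv.symm_apply_apply]

omit [NumberField F] in
/-- **`gramD (T₁ ⊕ᶠ T₂) = reindex blkIdx blkIdx (gramD T₁ ⊕ gramD T₂)`** — the doubled space of an orthogonal sum is the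
orthogonal sum of the doubled spaces. [cite: Kudla1994, §2] [cite: Kudla1984, §1] -/
theorem gramD_finSum :
    gramD F (n₁ + n₂) (UnitaryGroup.finSum n₁ n₂ T₁ T₂) =
      Matrix.reindex (blkIdx n₁ n₂) (blkIdx n₁ n₂) (Matrix.fromBlocks (gramD F n₁ T₁) 0 0 (gramD F n₂ T₂)) := by
  -- compare the two matrices after pulling back along `blkIdx`
  suffices h : (gramD F (n₁ + n₂) (UnitaryGroup.finSum n₁ n₂ T₁ T₂)).submatrix (blkIdx n₁ n₂) (blkIdx n₁ n₂) =
      Matrix.fromBlocks (gramD F n₁ T₁) 0 0 (gramD F n₂ T₂) by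
    rw [← h, Matrix.reindex_apply, Matrix.submatrix_submatrix, Equiv.self_comp_symm, Matrix.submatrix_id_id]
  ext a b
  rw [Matrix.submatrix_apply]
  rcases a with a | a <;> rcases b with b | b
  · obtain ⟨a, rfl⟩ := (e₂ n₁).surjective a
    obtain ⟨b, rfl⟩ := (e₂ n₁).surjective b
    rw [Matrix.fromBlocks_apply₁₁, gramD_apply]
    rcases a with a | a <;> rcases b with b | b <;>
      simp only [blkIdx_inl_inl, blkIdx_inl_inr, gramD_apply, Matrix.fromBlocks_apply₁₁, Matrix.fromBlocks_apply₁₂,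
        Matrix.fromBlocks_apply₂₁, Matrix.fromBlocks_apply₂₂, finSum_apply, Matrix.neg_apply, Matrix.zero_apply]
  · obtain ⟨a, rfl⟩ := (e₂ n₁).surjective a
    obtain ⟨b, rfl⟩ := (e₂ n₂).surjective b
    rw [Matrix.fromBlocks_apply₁₂, Matrix.zero_apply]
    rcases a with a | a <;> rcases b with b | b <;>
      simp only [blkIdx_inl_inl, blkIdx_inl_inr, blkIdx_inr_inl, blkIdx_inr_inr, gramD_apply, Matrix.fromBlocks_apply₁₁,
        Matrix.fromBlocks_apply₁₂, Matrix.fromBlocks_apply₂₁, Matrix.fromBlocks_apply₂₂, finSum_apply, Matrix.neg_apply,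
        Matrix.zero_apply, neg_zero]
  · obtain ⟨a, rfl⟩ := (e₂ n₂).surjective a
    obtain ⟨b, rfl⟩ := (e₂ n₁).surjective b
    rw [Matrix.fromBlocks_apply₂₁, Matrix.zero_apply]
    rcases a with a | a <;> rcases b with b | b <;>
      simp only [blkIdx_inl_inl, blkIdx_inl_inr, blkIdx_inr_inl, blkIdx_inr_inr, gramD_apply, Matrix.fromBlocks_apply₁₁,
        Matrix.fromBlocks_apply₁₂, Matrix.fromBlocks_apply₂₁, Matrix.fromBlocks_apply₂₂, finSum_apply, Matrix.neg_apply,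
        Matrix.zero_apply, neg_zero]
  · obtain ⟨a, rfl⟩ := (e₂ n₂).surjective a
    obtain ⟨b, rfl⟩ := (e₂ n₂).surjective b
    rw [Matrix.fromBlocks_apply₂₂, gramD_apply]
    rcases a with a | a <;> rcases b with b | b <;>
      simp only [blkIdx_inr_inl, blkIdx_inr_inr, gramD_apply, Matrix.fromBlocks_apply₁₁, Matrix.fromBlocks_apply₁₂,
        Matrix.fromBlocks_apply₂₁, Matrix.fromBlocks_apply₂₂, finSum_apply, Matrix.neg_apply, Matrix.zero_apply]

/-- **the local Gram matrix of the doubled sum is the shuffled sum of the local doubled Gram matrices**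
(base change commutes with the block structure). [cite: Kudla1994, §2] -/
theorem localGram_gramD_finSum :
    localGram F ((n₁ + n₂) + (n₁ + n₂)) (gramD F (n₁ + n₂) (UnitaryGroup.finSum n₁ n₂ T₁ T₂)) v =
      Matrix.reindex (blkIdx n₁ n₂) (blkIdx n₁ n₂)
        (Matrix.fromBlocks (localGram F (n₁ + n₁) (gramD F n₁ T₁) v) 0 0 (localGram F (n₂ + n₂) (gramD F n₂ T₂) v)) := by
  change (gramD F (n₁ + n₂) (UnitaryGroup.finSum n₁ n₂ T₁ T₂)).map (algebraMap F Fv) = _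
  rw [gramD_finSum, UnitaryGroup.reindex_map, UnitaryGroup.fromBlocks_diag_map]

/-! ## §2 The block embedding `U(J₁^𝔻)(F_v) →* U(J^𝔻)(F_v)` -/

include hJD₁ in
/-- `U(J₁^𝔻)(F_v)` (matrix form) is the unitary group of the local form matrix `HD₁`. [cite: HarrisKudlaSweet1996, §1 (1.9)] -/
theorem local_eq₁ : UnitaryGroup.«local» E c (n₁ + n₁) JD₁ v = unitaryGroupOfForm (UnitaryGroup.conjLocal E c v) HD₁ := by
  rw [UnitaryGroup.«local», UnitaryGroup.localForm_eq_map E (n₁ + n₁) v (gramD F n₁ T₁) hJD₁]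

include hJD in
/-- **the local form matrix of `J^𝔻 = gramD (T₁ ⊕ᶠ T₂) ⊗ 1` is the `blkIdx`-reindexed `HD₁ ⊕ HD₂`**.
[cite: Kudla1994, §2] [cite: Kudla1984, §1] -/
theorem local_eq :
    UnitaryGroup.«local» E c ((n₁ + n₂) + (n₁ + n₂)) JD v =
      unitaryGroupOfForm (UnitaryGroup.conjLocal E c v)
        (Matrix.reindex (blkIdx n₁ n₂) (blkIdx n₁ n₂) (Matrix.fromBlocks HD₁ 0 0 HD₂)) := by
  rw [UnitaryGroup.«local», UnitaryGroup.localForm_eq_map E ((n₁ + n₂) + (n₁ + n₂)) v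
    (gramD F (n₁ + n₂) (UnitaryGroup.finSum n₁ n₂ T₁ T₂)) hJD]
  change unitaryGroupOfForm _ ((localGram F ((n₁ + n₂) + (n₁ + n₂)) (gramD F (n₁ + n₂) (UnitaryGroup.finSum n₁ n₂ T₁ T₂)) v).map _) = _
  rw [localGram_gramD_finSum, UnitaryGroup.reindex_map, UnitaryGroup.fromBlocks_diag_map]

/-- **`U(J₁^𝔻)(F_v) →* U(J^𝔻)(F_v)`, `h ↦ h ⊕ 1` through `blkIdx`, on the matrix forms.** [cite: Kudla1984, §1] [cite: Kudla1994, §2] -/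
def blkLocal : UnitaryGroup.«local» E c (n₁ + n₁) JD₁ v →* UnitaryGroup.«local» E c ((n₁ + n₂) + (n₁ + n₂)) JD v where
  toFun h := ⟨UnitaryGroup.reindexGL (blkIdx n₁ n₂)
      (UnitaryGroup.blockDiagGL ((h : GL (Fin (n₁ + n₁)) (UnitaryGroup.LocalRing E v)), 1)), by
    have hh : (h : GL (Fin (n₁ + n₁)) (UnitaryGroup.LocalRing E v)) ∈ unitaryGroupOfForm (UnitaryGroup.conjLocal E c v) HD₁ := by
      rw [← local_eq₁ F E c v n₁ hJD₁]; exact h.2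
    rw [local_eq F E c v n₁ n₂ hJD]
    exact (UnitaryGroup.reindexGL_mem_iff _ _ _ _).2 (UnitaryGroup.blockDiagGL_mem _ hh (one_mem _))⟩
  map_one' := Subtype.ext (by
    change UnitaryGroup.reindexGL (blkIdx n₁ n₂) (UnitaryGroup.blockDiagGL
      ((((1 : UnitaryGroup.«local» E c (n₁ + n₁) JD₁ v) : UnitaryGroup.«local» E c (n₁ + n₁) JD₁ v) :
        GL (Fin (n₁ + n₁)) (UnitaryGroup.LocalRing E v)), 1)) =
      (((1 : UnitaryGroup.«local» E c ((n₁ + n₂) + (n₁ + n₂)) JD v) : UnitaryGroup.«local» E c ((n₁ + n₂) + (n₁ + n₂)) JD v) :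
        GL (Fin ((n₁ + n₂) + (n₁ + n₂))) (UnitaryGroup.LocalRing E v))
    rw [OneMemClass.coe_one, OneMemClass.coe_one, ← Prod.one_eq_mk, map_one, map_one])
  map_mul' h h' := Subtype.ext (by
    change UnitaryGroup.reindexGL (blkIdx n₁ n₂) (UnitaryGroup.blockDiagGL
      (((h * h' : UnitaryGroup.«local» E c (n₁ + n₁) JD₁ v) : GL (Fin (n₁ + n₁)) (UnitaryGroup.LocalRing E v)), 1)) =
      UnitaryGroup.reindexGL (blkIdx n₁ n₂) (UnitaryGroup.blockDiagGL ((h : GL (Fin (n₁ + n₁)) (UnitaryGroup.LocalRing E v)), 1)) *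
        UnitaryGroup.reindexGL (blkIdx n₁ n₂) (UnitaryGroup.blockDiagGL ((h' : GL (Fin (n₁ + n₁)) (UnitaryGroup.LocalRing E v)), 1))
    rw [Subgroup.coe_mul, ← map_mul, ← map_mul, Prod.mk_mul_mk, mul_one])

/-- matrix of `blkLocal h`: `reindex blkIdx blkIdx (h ⊕ 1)`. [cite: Kudla1984, §1] -/
@[simp] theorem coe_blkLocal (h : UnitaryGroup.«local» E c (n₁ + n₁) JD₁ v) :
    ((blkLocal F E c v n₁ n₂ hJD₁ hJD h : UnitaryGroup.«local» E c ((n₁ + n₂) + (n₁ + n₂)) JD v) :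
        GL (Fin ((n₁ + n₂) + (n₁ + n₂))) (UnitaryGroup.LocalRing E v)) =
      UnitaryGroup.reindexGL (blkIdx n₁ n₂) (UnitaryGroup.blockDiagGL ((h : GL (Fin (n₁ + n₁)) (UnitaryGroup.LocalRing E v)), 1)) :=
  rfl

/-- `blkLocal` is continuous. [cite: Kudla1984, §1] -/
theorem continuous_blkLocal : Continuous (blkLocal F E c v n₁ n₂ hJD₁ hJD) := by
  refine Continuous.subtype_mk ?_ _
  exact (UnitaryGroup.continuous_reindexGL (blkIdx n₁ n₂)).comp
    (UnitaryGroup.continuous_blockDiagGL.comp (continuous_subtype_val.prodMk continuous_const))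

/-- **`U(J₁^𝔻)(F_v) →* U(J^𝔻)(F_v)`, `h ↦ h ⊕ 1` through `blkIdx`, on the factor forms `localPi`.** [cite: Kudla1984, §1] -/
def blkLoc : UnitaryGroup.localPi E c (n₁ + n₁) JD₁ v →* UnitaryGroup.localPi E c ((n₁ + n₂) + (n₁ + n₂)) JD v :=
  ((UnitaryGroup.localPiEquiv E c ((n₁ + n₂) + (n₁ + n₂)) JD v).symm.toMonoidHom.comp (blkLocal F E c v n₁ n₂ hJD₁ hJD)).comp
    (UnitaryGroup.localPiEquiv E c (n₁ + n₁) JD₁ v).toMonoidHom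

/-- unfolding: `localPiEquiv (blkLoc h) = blkLocal (localPiEquiv h)`. [cite: Kudla1984, §1] -/
theorem localPiEquiv_blkLoc (h : UnitaryGroup.localPi E c (n₁ + n₁) JD₁ v) :
    UnitaryGroup.localPiEquiv E c ((n₁ + n₂) + (n₁ + n₂)) JD v (blkLoc F E c v n₁ n₂ hJD₁ hJD h) =
      blkLocal F E c v n₁ n₂ hJD₁ hJD (UnitaryGroup.localPiEquiv E c (n₁ + n₁) JD₁ v h) := by
  rw [blkLoc, MonoidHom.comp_apply, MonoidHom.comp_apply]
  exact (UnitaryGroup.localPiEquiv E c ((n₁ + n₂) + (n₁ + n₂)) JD v).apply_symm_apply _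

/-- `blkLoc` is continuous. [cite: Kudla1984, §1] -/
theorem continuous_blkLoc : Continuous (blkLoc F E c v n₁ n₂ hJD₁ hJD) :=
  ((UnitaryGroup.localPiEquiv E c ((n₁ + n₂) + (n₁ + n₂)) JD v).symm.continuous.comp
    (continuous_blkLocal F E c v n₁ n₂ hJD₁ hJD)).comp (UnitaryGroup.localPiEquiv E c (n₁ + n₁) JD₁ v).continuous

/-- **components of `blkLoc h`**: `(blkLoc h)_w = reindex blkIdx (h_w ⊕ 1)` in `GL(E_w)` for every `w ∣ v`. [cite: Kudla1984, §1] -/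
theorem blkLoc_apply (h : UnitaryGroup.localPi E c (n₁ + n₁) JD₁ v) (w : UnitaryGroup.PlacesOver E v) :
    ((blkLoc F E c v n₁ n₂ hJD₁ hJD h : UnitaryGroup.localPi E c ((n₁ + n₂) + (n₁ + n₂)) JD v) :
        UnitaryGroup.LocalGLPi E ((n₁ + n₂) + (n₁ + n₂)) v) w =
      UnitaryGroup.reindexGL (blkIdx n₁ n₂) (UnitaryGroup.blockDiagGL ((h : UnitaryGroup.LocalGLPi E (n₁ + n₁) v) w, 1)) := by
  refine Units.ext ?_
  rw [show blkLoc F E c v n₁ n₂ hJD₁ hJD h = (UnitaryGroup.localPiEquiv E c ((n₁ + n₂) + (n₁ + n₂)) JD v).symm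
      (blkLocal F E c v n₁ n₂ hJD₁ hJD (UnitaryGroup.localPiEquiv E c (n₁ + n₁) JD₁ v h)) from rfl,
    UnitaryGroup.coe_localPiEquiv_symm_apply, GLn.coe_piEquiv_apply, coe_blkLocal, UnitaryGroup.coe_reindexGL,
    UnitaryGroup.coe_blockDiagGL, UnitaryGroup.reindex_map, Matrix.fromBlocks_map, UnitaryGroup.coe_localPiEquiv_apply,
    GLn.map_piEquiv_symm, UnitaryGroup.coe_reindexGL, UnitaryGroup.coe_blockDiagGL, Units.val_one,
    Matrix.map_zero _ (map_zero _), Matrix.map_one _ (map_zero _) (map_one _)]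
  rfl

variable [Algebra.IsQuadraticExtension F E] {δ : E} (hcδ : c δ = -δ) (hδ : δ ≠ 0) {d : F} (hd : δ * δ = algebraMap F E d)
  (hT₁ : T₁.IsSymm) (hT₂ : T₂.IsSymm) (hT₁d : IsUnit T₁.det) (hT₂d : IsUnit T₂.det)

/-- **the embedding of the doubled sum restricted to the first doubled block is `spInl blkIdx`**:
`ι^𝔻_T(blkLoc h) = spInl blkIdx (ι^𝔻_{T₁} h)` in `Sp(𝕎^𝔻_T) = Sp(𝕎^𝔻_{T₁} ⊕ 𝕎^𝔻_{T₂})`. [cite: Kudla1984, §1] [cite: Kudla1994, §2] -/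
theorem iota_blkLoc (h : UnitaryGroup.localPi E c (n₁ + n₁) JD₁ v) :
    iota F E c ((n₁ + n₂) + (n₁ + n₂)) hcδ hδ hd (gramD F (n₁ + n₂) (UnitaryGroup.finSum n₁ n₂ T₁ T₂))
        (gramD_isSymm F (n₁ + n₂) (UnitaryGroup.isSymm_finSum hT₁ hT₂)) hJD v (blkLoc F E c v n₁ n₂ hJD₁ hJD h) =
      spInl (blkIdx n₁ n₂) (localGram F (n₁ + n₁) (gramD F n₁ T₁) v) (localGram F (n₂ + n₂) (gramD F n₂ T₂) v)
        (localGram_gramD_finSum F v n₁ n₂) (iota F E c (n₁ + n₁) hcδ hδ hd (gramD F n₁ T₁) (gramD_isSymm F n₁ hT₁) hJD₁ v h) := by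
  rw [iota_def, iota_def]
  refine Subtype.ext ?_
  change (UnitaryGroup.isQuadraticCoordinates_local E v c hcδ hδ hd).resAut (Fin ((n₁ + n₂) + (n₁ + n₂)))
      ((UnitaryGroup.localPiEquiv E c ((n₁ + n₂) + (n₁ + n₂)) JD v (blkLoc F E c v n₁ n₂ hJD₁ hJD h) :
        UnitaryGroup.«local» E c ((n₁ + n₂) + (n₁ + n₂)) JD v) : GL (Fin ((n₁ + n₂) + (n₁ + n₂))) (UnitaryGroup.LocalRing E v)) =
    inlW (blkIdx n₁ n₂) ((UnitaryGroup.isQuadraticCoordinates_local E v c hcδ hδ hd).resAut (Fin (n₁ + n₁))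
      ((UnitaryGroup.localPiEquiv E c (n₁ + n₁) JD₁ v h : UnitaryGroup.«local» E c (n₁ + n₁) JD₁ v) :
        GL (Fin (n₁ + n₁)) (UnitaryGroup.LocalRing E v)))
  rw [localPiEquiv_blkLoc, coe_blkLocal, (UnitaryGroup.isQuadraticCoordinates_local E v c hcδ hδ hd).resAut_reindexGL,
    (UnitaryGroup.isQuadraticCoordinates_local E v c hcδ hδ hd).resAut_blockDiagGL, inlW_eq_reindexW_spSumEquiv]
  simp only [map_one]


/-! ## §3 The block section of a doubled section, and `j̃` at the local doubled models -/

variable (s : UnitaryGroup.localPi E c ((n₁ + n₂) + (n₁ + n₂)) JD v →*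
    LocalMp F ((n₁ + n₂) + (n₁ + n₂)) (gramD F (n₁ + n₂) (UnitaryGroup.finSum n₁ n₂ T₁ T₂)) v)
  (hs : ∀ h, MpPsi.proj _ (s h) = iota F E c ((n₁ + n₂) + (n₁ + n₂)) hcδ hδ hd (gramD F (n₁ + n₂) (UnitaryGroup.finSum n₁ n₂ T₁ T₂))
    (gramD_isSymm F (n₁ + n₂) (UnitaryGroup.isSymm_finSum hT₁ hT₂)) hJD v h)

include hT₁ hT₂ hs in
/-- `s ∘ blkLoc` lies over `spInl blkIdx ∘ ι^𝔻_{T₁}`. [cite: Kudla1984, §1] -/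
theorem proj_comp_blkLoc (h : UnitaryGroup.localPi E c (n₁ + n₁) JD₁ v) :
    MpPsi.proj (schrodingerSB (Matrix.toLinearMap₂' Fv (localGram F ((n₁ + n₂) + (n₁ + n₂))
        (gramD F (n₁ + n₂) (UnitaryGroup.finSum n₁ n₂ T₁ T₂)) v)) (adeleAddCharAt F v) hlv
        (continuous_toLinearMap₂'_left (localGram F ((n₁ + n₂) + (n₁ + n₂)) (gramD F (n₁ + n₂) (UnitaryGroup.finSum n₁ n₂ T₁ T₂)) v)))
      ((s.comp (blkLoc F E c v n₁ n₂ hJD₁ hJD)) h) =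
      spInl (blkIdx n₁ n₂) (localGram F (n₁ + n₁) (gramD F n₁ T₁) v) (localGram F (n₂ + n₂) (gramD F n₂ T₂) v)
        (localGram_gramD_finSum F v n₁ n₂) (iota F E c (n₁ + n₁) hcδ hδ hd (gramD F n₁ T₁) (gramD_isSymm F n₁ hT₁) hJD₁ v h) :=
  (hs (blkLoc F E c v n₁ n₂ hJD₁ hJD h)).trans (iota_blkLoc F E c v n₁ n₂ hJD₁ hJD hcδ hδ hd hT₁ hT₂ h)

/-- **THE BLOCK SECTION**: a doubled section `s : U(T^𝔻)(F_v) →* S̃p(𝕎^𝔻_T)` over `ι^𝔻_T` restricts along `blkLoc` and strips the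
second doubled block: `restrictBlk s : U(T₁^𝔻)(F_v) →* S̃p(𝕎^𝔻_{T₁})`. [cite: MoeglinVignerasWaldspurger1987, Chap. 2 II.1 Rem. (6)] [cite: Kudla1994, §3] -/
def restrictBlk : UnitaryGroup.localPi E c (n₁ + n₁) JD₁ v →* LocalMp F (n₁ + n₁) (gramD F n₁ T₁) v :=
  undouble (blkIdx n₁ n₂) (localGram F (n₁ + n₁) (gramD F n₁ T₁) v) (localGram F (n₂ + n₂) (gramD F n₂ T₂) v)
    (localGram_gramD_finSum F v n₁ n₂) (BlockSum.isUnit_det_localGram F v (isUnit_det_gramD F n₂ hT₂d)) hlv hψv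
    (continuous_toLinearMap₂'_left (localGram F (n₁ + n₁) (gramD F n₁ T₁) v))
    (continuous_toLinearMap₂'_left (localGram F (n₂ + n₂) (gramD F n₂ T₂) v))
    (continuous_toLinearMap₂'_left (localGram F ((n₁ + n₂) + (n₁ + n₂)) (gramD F (n₁ + n₂) (UnitaryGroup.finSum n₁ n₂ T₁ T₂)) v))
    (iota F E c (n₁ + n₁) hcδ hδ hd (gramD F n₁ T₁) (gramD_isSymm F n₁ hT₁) hJD₁ v) (s.comp (blkLoc F E c v n₁ n₂ hJD₁ hJD))
    (proj_comp_blkLoc F E c v n₁ n₂ hJD₁ hJD hcδ hδ hd hT₁ hT₂ s hs)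

/-- **`restrictBlk s` lies over `ι^𝔻_{T₁}`.** [cite: MoeglinVignerasWaldspurger1987, Chap. 2 II.1 Rem. (6)] -/
theorem proj_restrictBlk (h : UnitaryGroup.localPi E c (n₁ + n₁) JD₁ v) :
    MpPsi.proj _ (restrictBlk F E c v n₁ n₂ hJD₁ hJD hcδ hδ hd hT₁ hT₂ hT₂d s hs h) =
      iota F E c (n₁ + n₁) hcδ hδ hd (gramD F n₁ T₁) (gramD_isSymm F n₁ hT₁) hJD₁ v h :=
  proj_undouble (blkIdx n₁ n₂) (localGram F (n₁ + n₁) (gramD F n₁ T₁) v) (localGram F (n₂ + n₂) (gramD F n₂ T₂) v)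
    (localGram_gramD_finSum F v n₁ n₂) (BlockSum.isUnit_det_localGram F v (isUnit_det_gramD F n₂ hT₂d)) hlv hψv
    (continuous_toLinearMap₂'_left (localGram F (n₁ + n₁) (gramD F n₁ T₁) v))
    (continuous_toLinearMap₂'_left (localGram F (n₂ + n₂) (gramD F n₂ T₂) v))
    (continuous_toLinearMap₂'_left (localGram F ((n₁ + n₂) + (n₁ + n₂)) (gramD F (n₁ + n₂) (UnitaryGroup.finSum n₁ n₂ T₁ T₂)) v))
    (iota F E c (n₁ + n₁) hcδ hδ hd (gramD F n₁ T₁) (gramD_isSymm F n₁ hT₁) hJD₁ v) (s.comp (blkLoc F E c v n₁ n₂ hJD₁ hJD))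
    (proj_comp_blkLoc F E c v n₁ n₂ hJD₁ hJD hcδ hδ hd hT₁ hT₂ s hs) h

/-- **`ω(s (blkLoc h))(Φ₁ ⊠_{blkIdx} Φ₂) = ω(restrictBlk s h) Φ₁ ⊠ Φ₂`.** [cite: MoeglinVignerasWaldspurger1987, Chap. 2 II.1 Rem. (6)] -/
theorem toRep_blkLoc_boxSB (h : UnitaryGroup.localPi E c (n₁ + n₁) JD₁ v) (Φ₁ : SchwartzBruhat (Fin (n₁ + n₁) → Fv))
    (Φ₂ : SchwartzBruhat (Fin (n₂ + n₂) → Fv)) :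
    MpPsi.toRep (localSchrodinger F ((n₁ + n₂) + (n₁ + n₂)) (gramD F (n₁ + n₂) (UnitaryGroup.finSum n₁ n₂ T₁ T₂)) v)
        (s (blkLoc F E c v n₁ n₂ hJD₁ hJD h)) (boxSB Fv (blkIdx n₁ n₂) Φ₁ Φ₂) =
      boxSB Fv (blkIdx n₁ n₂) (MpPsi.toRep (localSchrodinger F (n₁ + n₁) (gramD F n₁ T₁) v)
        (restrictBlk F E c v n₁ n₂ hJD₁ hJD hcδ hδ hd hT₁ hT₂ hT₂d s hs h) Φ₁) Φ₂ :=
  toRep_apply_boxSB_undouble (blkIdx n₁ n₂) (localGram F (n₁ + n₁) (gramD F n₁ T₁) v) (localGram F (n₂ + n₂) (gramD F n₂ T₂) v)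
    (localGram_gramD_finSum F v n₁ n₂) (BlockSum.isUnit_det_localGram F v (isUnit_det_gramD F n₂ hT₂d)) hlv hψv
    (continuous_toLinearMap₂'_left (localGram F (n₁ + n₁) (gramD F n₁ T₁) v))
    (continuous_toLinearMap₂'_left (localGram F (n₂ + n₂) (gramD F n₂ T₂) v))
    (continuous_toLinearMap₂'_left (localGram F ((n₁ + n₂) + (n₁ + n₂)) (gramD F (n₁ + n₂) (UnitaryGroup.finSum n₁ n₂ T₁ T₂)) v))
    (iota F E c (n₁ + n₁) hcδ hδ hd (gramD F n₁ T₁) (gramD_isSymm F n₁ hT₁) hJD₁ v) (s.comp (blkLoc F E c v n₁ n₂ hJD₁ hJD))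
    (proj_comp_blkLoc F E c v n₁ n₂ hJD₁ hJD hcδ hδ hd hT₁ hT₂ s hs) h Φ₁ Φ₂

/-- **Kudla's `j̃` at the local doubled models**: `boxLoc : S̃p(𝕎^𝔻_{T₁}) × S̃p(𝕎^𝔻_{T₂}) →* S̃p(𝕎^𝔻_{T₁ ⊕ᶠ T₂})`, the tree's
`MpPsi.boxHom` along `blkIdx`, typed at the `LocalMp` models (so that products with local sections elaborate).
[cite: MoeglinVignerasWaldspurger1987, Chap. 2 II.1 Rem. (6)] [cite: Kudla1994, §2] -/
def boxLoc : LocalMp F (n₁ + n₁) (gramD F n₁ T₁) v × LocalMp F (n₂ + n₂) (gramD F n₂ T₂) v →*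
    LocalMp F ((n₁ + n₂) + (n₁ + n₂)) (gramD F (n₁ + n₂) (UnitaryGroup.finSum n₁ n₂ T₁ T₂)) v :=
  MpPsi.boxHom (blkIdx n₁ n₂) (localGram F (n₁ + n₁) (gramD F n₁ T₁) v) (localGram F (n₂ + n₂) (gramD F n₂ T₂) v)
    (localGram_gramD_finSum F v n₁ n₂) hlv
    (continuous_toLinearMap₂'_left (localGram F (n₁ + n₁) (gramD F n₁ T₁) v))
    (continuous_toLinearMap₂'_left (localGram F (n₂ + n₂) (gramD F n₂ T₂) v))
    (continuous_toLinearMap₂'_left (localGram F ((n₁ + n₂) + (n₁ + n₂)) (gramD F (n₁ + n₂) (UnitaryGroup.finSum n₁ n₂ T₁ T₂)) v))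

omit [NumberField E] [Algebra.IsQuadraticExtension F E] in
/-- `π(j̃(p₁, p₂)) = spInl π(p₁) · spInr π(p₂)`. [cite: MoeglinVignerasWaldspurger1987, Chap. 2 II.1 Rem. (6)] -/
theorem proj_boxLoc (p₁ : LocalMp F (n₁ + n₁) (gramD F n₁ T₁) v) (p₂ : LocalMp F (n₂ + n₂) (gramD F n₂ T₂) v) :
    MpPsi.proj _ (boxLoc F v n₁ n₂ (T₁ := T₁) (T₂ := T₂) (p₁, p₂)) =
      spInl (blkIdx n₁ n₂) (localGram F (n₁ + n₁) (gramD F n₁ T₁) v) (localGram F (n₂ + n₂) (gramD F n₂ T₂) v)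
          (localGram_gramD_finSum F v n₁ n₂) (MpPsi.proj _ p₁) *
        spInr (blkIdx n₁ n₂) (localGram F (n₁ + n₁) (gramD F n₁ T₁) v) (localGram F (n₂ + n₂) (gramD F n₂ T₂) v)
          (localGram_gramD_finSum F v n₁ n₂) (MpPsi.proj _ p₂) :=
  rfl

omit [NumberField E] [Algebra.IsQuadraticExtension F E] in
/-- **`ω(j̃(p₁, p₂))(Φ₁ ⊠_{blkIdx} Φ₂) = ω(p₁) Φ₁ ⊠ ω(p₂) Φ₂`.** [cite: MoeglinVignerasWaldspurger1987, Chap. 2 II.1 Rem. (6)] -/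
theorem toRep_boxLoc_boxSB (p₁ : LocalMp F (n₁ + n₁) (gramD F n₁ T₁) v) (p₂ : LocalMp F (n₂ + n₂) (gramD F n₂ T₂) v)
    (Φ₁ : SchwartzBruhat (Fin (n₁ + n₁) → Fv)) (Φ₂ : SchwartzBruhat (Fin (n₂ + n₂) → Fv)) :
    MpPsi.toRep (localSchrodinger F ((n₁ + n₂) + (n₁ + n₂)) (gramD F (n₁ + n₂) (UnitaryGroup.finSum n₁ n₂ T₁ T₂)) v)
        (boxLoc F v n₁ n₂ (T₁ := T₁) (T₂ := T₂) (p₁, p₂)) (boxSB Fv (blkIdx n₁ n₂) Φ₁ Φ₂) =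
      boxSB Fv (blkIdx n₁ n₂) (MpPsi.toRep (localSchrodinger F (n₁ + n₁) (gramD F n₁ T₁) v) p₁ Φ₁)
        (MpPsi.toRep (localSchrodinger F (n₂ + n₂) (gramD F n₂ T₂) v) p₂ Φ₂) :=
  MpPsi.toRep_boxHom_boxSB (blkIdx n₁ n₂) (localGram F (n₁ + n₁) (gramD F n₁ T₁) v) (localGram F (n₂ + n₂) (gramD F n₂ T₂) v)
    (localGram_gramD_finSum F v n₁ n₂) hlv
    (continuous_toLinearMap₂'_left (localGram F (n₁ + n₁) (gramD F n₁ T₁) v))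
    (continuous_toLinearMap₂'_left (localGram F (n₂ + n₂) (gramD F n₂ T₂) v))
    (continuous_toLinearMap₂'_left (localGram F ((n₁ + n₂) + (n₁ + n₂)) (gramD F (n₁ + n₂) (UnitaryGroup.finSum n₁ n₂ T₁ T₂)) v))
    p₁ p₂ Φ₁ Φ₂

omit [NumberField E] [Algebra.IsQuadraticExtension F E] in
/-- the operator of `j̃(p₁, p₂)` is `op p₁ ⊠ op p₂`. [cite: MoeglinVignerasWaldspurger1987, Chap. 2 II.1 Rem. (6)] -/
theorem toOp_boxLoc (p₁ : LocalMp F (n₁ + n₁) (gramD F n₁ T₁) v) (p₂ : LocalMp F (n₂ + n₂) (gramD F n₂ T₂) v) :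
    MpPsi.toOp _ (boxLoc F v n₁ n₂ (T₁ := T₁) (T₂ := T₂) (p₁, p₂)) = boxEquivSB Fv (blkIdx n₁ n₂) (MpPsi.toOp _ p₁) (MpPsi.toOp _ p₂) :=
  rfl


end DoubledBlock

end Literature.NumberTheory.GelbartRogawski1991.UnitaryDualPair.LocalSplitting

end
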